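import Literature.AlgebraicGeometry.ComplexMultiplication.CyclotomicFermatCMTypesPrimePowerIsogenies
import HarnessLib

/-!
# Koblitz–Rohrlich at prime-power level for ALL pairs of triples — no g.c.d. hypothesis — by descent along the change of level
# `pⁿ = p·pⁿ⁻¹`: THEOREM 1 at `pⁿ`, `p ≥ 5` (`H_{τ′} = H_τ ⟺ τ′` is a permutation of `τ`) and THEOREM 3 VERBATIM at `3ⁿ` (v2, §5)

Layer `Literature/AlgebraicGeometry/ComplexMultiplication`, namespace `…ComplexMultiplication.CyclotomicFermatCMType`; sequel of
`CyclotomicFermatCMTypesPrimePowerCoincidences` (the case "a unit among the six entries", i.e. g.c.d.`(N, r, …, t′) = 1`),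
`CyclotomicFermatCMTypesLevelPullback` (the change of level `H_{(da,db,dc)} ↔ H_{(a,b,c)}`) and `CyclotomicFermatCMTypesPrimePowerIsogenies`
(`A_τ ∼ A_{τ′} ⟺ H_{τ′} = H_{uτ}`).  THEOREMS ONLY (no definition, no named fact, no `sorry`, no kernel `decide`).

THE SOURCE.  N. Koblitz, D. Rohrlich, *Simple factors in the Jacobian of a Fermat curve*, Canad. J. Math. **30** (1978) 1183–1205:
§1 (pp. 1183–1184) "let `M` be the integer defined by `N/M = g.c.d.(N, r, s)` … `H_{r,s}` … subset of `(ℤ/Mℤ)*` … `L_{r,s}` as the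
lattice in `ℂ^{φ(M)/2}`"; THEOREM 1 (p. 1185) "(i) If `#H_{r,s,t}` … [for `N` prime to `6`] … (ii) The only isogenies between the
lattices `L_{r,s,t}` are the obvious equalities"; §3 PROPOSITION (p. 1193) "Suppose g.c.d. `(r, s, t, r′, s′, t′) = 1` … `H_τ = H_{τ′}`.
Then `τ′` is a permutation of `τ`."  K–R compare triples at their own level `M`; the tree reads every `H_τ` at the full level `N`
(`fermatCMType N`), where triples of `p`-content `pᵐ` define the pull-backs of level-`pⁿ⁻ᵐ` sets.  THIS FILE shows that at `N = pⁿ`,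
`p ≥ 5`, the conclusion "`τ′` is a permutation of `τ`" survives WITHOUT the g.c.d. hypothesis: coincidences between pull-backs
descend level by level to a coincidence with a unit entry.

## What is proved

* §1 (any `N = d·M`, `d ≥ 1`, entries `d·a` for naturals `a`): `mul_natCast_val_castHom` (`d·⟨y mod M⟩ = d·y` modulo `dM`),
  `natCast_mul_eq_mul_val`, **`fermatCMType_eq_of_fermatCMType_level_mul_eq`** (`H_{(da′,db′,dc′)} = H_{(da,db,dc)}` modulo `dM` ⟹
  `H_{(a′,b′,c′)} = H_{(a,b,c)}` modulo `M`; units lift, `ZMod.unitsMap_surjective`) — the converse of the sibling's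
  `fermatCMType_level_mul_eq_of_eq`, whence `fermatCMType_level_mul_eq_iff`; `multiset_level_mul_eq_of_multiset_eq` (permutations
  lift).  (The sibling `…ThreePowerLevelComplete` §1 is the case `d = 3ᵐ`, `M = 3ᵏ`.)
* §2 (private plumbing; transport along an equality of levels `N = N′`, Mathlib's `ZMod.ringEquivCongr`): equality of Fermat sets
  and equality of triples are invariant — used with `p^(k+1) = p·pᵏ`.
* §3 (`N = p^(k+1)`): a non-zero NON-unit residue `a` is `p·a₁` with `0 < a₁ < pᵏ`, read at level `p·pᵏ`
  (`exists_val_eq_mul_of_not_isUnit`); sums (`natCast_add_eq_zero_of_val_eq_mul`).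
* §4 **`multiset_eq_of_fermatCMType_eq_primePow_all`** (`p ≥ 5` prime, `n ≥ 1`): for ANY triples `τ = (r,s,t)`, `τ′ = (r′,s′,t′)` of
  non-zero residues modulo `pⁿ` with `r + s + t = 0 = r′ + s′ + t′`: `H_{τ′} = H_τ ⟹ {r′,s′,t′} = {r,s,t}` (induction on `n`: a unit
  among the six ⟹ sibling `multiset_eq_of_fermatCMType_eq_primePow_five_le`; otherwise all six are multiples of `p`, the coincidence
  descends to level `pⁿ⁻¹` by §§1–3 and the permutation lifts back); **`fermatCMType_eq_iff_multiset_eq_primePow_all`** (`⟺`);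
  the translate form `forall_mem_fermatCMType_iff_iff_multiset_eq_primePow_all`; and ON ABELIAN VARIETIES
  **`isIsogenous_fermatCMType_iff_exists_multiset_eq_primePow_all`**: abelian varieties of types `Φ_{H_τ}`, `Φ_{H_{τ′}}` of `ℚ(ζ_{pⁿ})`
  (any admissible `τ, τ′`) are isogenous iff `{r′,s′,t′} = {ur, us, ut}` for a unit `u`.
* §5 (v2; any prime `p` for the lift lemmas, then `p = 3`): `natCast_mul_val_natCast_eq` (`p·⟨x mod pᵏ⟩ = p·x` modulo `p^(k+1)`),
  `multiset_mul_eq_of_multiset_eq_succ` (permutations lift `pᵏ → p^(k+1)`), **`exists_unit_mul_natCast_mul_eq`** /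
  `exists_unit_multiset_mul_eq_succ` (a unit `w₀` modulo `pᵏ` lifts to a unit `W` modulo `p^(k+1)` with `W·(pa) = p·x` whenever
  `w₀a = x`, so unit relations between triples lift); `threePow_lift_arith`, `threePow_pair_zero_eq` (bookkeeping); and
  **`perm_or_exceptional_of_fermatCMType_eq_threePow_all` — THEOREM 3 VERBATIM in the one type `ℤ/3ⁿ`**: for ANY triples `τ, τ′` of
  non-zero residues modulo `3ⁿ` (`n ≥ 1`) with sums `0`, `H_{τ′} = H_τ` ⟹ `{τ′} = {τ}` or, for some `m` with `m + 2 ≤ n` and a unit `w`,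
  `(wτ, wτ′)` is `((3ᵐ, 3ⁿ⁻¹ − 2·3ᵐ, 2·3ⁿ⁻¹ + 3ᵐ), (3ᵐ⁺¹, 3ⁿ⁻¹ − 2·3ᵐ, 2·3ⁿ⁻¹ − 3ᵐ))` up to order (or exchanged) — induction on `n`,
  the sibling's §4 Proposition (`m = 0`) at each level with a unit entry, the lift `m ↦ m + 1` otherwise; as an EQUIVALENCE
  **`fermatCMType_eq_iff_perm_or_exceptional_threePow_all`** ("⟸" by the sibling's `fermatCMType_threePow_eq`).
* §6 (v3) **THEOREM 3 ON ABELIAN VARIETIES, all pairs of admissible triples** `isIsogenous_iff_obvious_or_exceptional_threePow_all`: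
  `A_τ ∼ A_{τ′}` iff `{τ′} = {uτ}` for a unit `u`, or for some `m` (`m + 2 ≤ n`) and units `w, w′` the pair `(wτ, w′τ′)` is one of
  Theorem 3's pairs up to order (or exchanged).

## Honest column / NOT here

* K–R never state the g.c.d.-free form: for them `L_τ` lives at level `M = N/`g.c.d. and lattices of different levels are not
  compared.  In the tree's reading (all `H_τ` at the full level `pⁿ`) the g.c.d.-free statement is meaningful and, for `p ≥ 5`, has
  the same answer; it is a COROLLARY of the printed Theorem 1 (i) + §3 Proposition by the change of level of §1, not a printed claim —
  cites locate §1's level bookkeeping and Theorem 1.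
* `p = 3` (§5, v2): the descent meets Theorem 3's pairs, the answer is K–R's full list "for `0 ≤ m ≤ n − 2`" (the sibling
  `…ThreePowerLevelComplete` has it at the product level `3ᵐ·3ᵏ` for entries prescribed as `3ᵐ`-multiples; here the `3`-content is
  found by the induction); §6 (v3) is the isogeny form on abelian varieties for all admissible triples (the sibling
  `…PrimePowerIsogenies` has it with a unit among the six); `p = 2` and composite `N` are out of scope.
* The residue-set input is the siblings' (parity road, ours — not K–R's §3 estimates).

## References

* [KoblitzRohrlich1978] N. Koblitz, D. Rohrlich, Canad. J. Math. 30 (1978) 1183–1205: §1 (pp. 1183–1184), Theorem 1 (p. 1185), Theorem 3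
  (p. 1186), §3 Proposition (p. 1193), §4 Proposition (p. 1198).
* [Shimura1998] G. Shimura, *Abelian Varieties with Complex Multiplication and Modular Functions*, §8.4 Example (1), §6.1 Corollary
  (through `CyclotomicCMTypeIsogenyClasses`).

## Provenance

Cell `pub-hodgecm2` (COR-CM), literature seat `lit-deligne-3` gen 37 (claim KR78-PRIMEPOWER-ALLTRIPLES; count-neutral, own lane); §5
appended by the same seat (claim KR78-THREEPOWER-ALLTRIPLES, append-only v2); §6 likewise (claim KR78-THREEPOWER-ALLTRIPLES-AV,
append-only v3).
-/

noncomputable section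

open NumberField

namespace Literature.AlgebraicGeometry.ComplexMultiplication

open Literature.NumberTheory.ComplexMultiplication
open Literature.NumberTheory.LFunctions
open Literature.AlgebraicGeometry.Motives (CMType)
open Literature.AlgebraicGeometry.HodgeTheory (fermatCMType)
open Literature.AlgebraicGeometry.Pohlmann1968 Literature.AlgebraicGeometry.Pohlmann1968.Cyclotomic

namespace CyclotomicFermatCMType

/-! ## §1 Change of level `N = d·M`: equal pull-backs come from equal sets; permutations lift -/

section Level

variable {M d : ℕ}

/-- **`d·⟨ȳ⟩ = d·y` modulo `d·M`**: the `d`-multiple of a residue `y` modulo `dM` depends only on `y mod M` ("`L_{r,s} = L_{⟨hr⟩,⟨hs⟩}`",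
"`N/M = g.c.d.(N, r, s)`"; the sibling's `pow_mul_natCast_val_castHom` is `d = 3ᵐ`, `M = 3ᵏ`). [cite: KoblitzRohrlich1978, §1 (pp. 1183–1184)] -/
theorem mul_natCast_val_castHom [NeZero M] [NeZero (d * M)] (y : ZMod (d * M)) :
    ((d : ℕ) : ZMod (d * M)) * ((ZMod.castHom (dvd_mul_left M d) (ZMod M) y).val : ZMod (d * M)) = ((d : ℕ) : ZMod (d * M)) * y := by
  have hv : (ZMod.castHom (dvd_mul_left M d) (ZMod M) y).val = y.val % M := by
    rw [ZMod.castHom_apply, ZMod.cast_eq_val, ZMod.val_natCast]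
  conv_rhs => rw [← ZMod.natCast_zmod_val y]
  rw [hv, ← Nat.cast_mul, ← Nat.cast_mul, ZMod.natCast_eq_natCast_iff']
  have e : d * y.val = d * (y.val % M) + d * M * (y.val / M) := by
    rw [mul_assoc, ← Nat.mul_add, Nat.mod_add_div]
  rw [e, Nat.add_mul_mod_self_left]

/-- The `d`-multiple of a natural number `a` modulo `dM` is the value at `a mod M` of the transfer map `z ↦ d·⟨z⟩`.
[cite: KoblitzRohrlich1978, §1 (pp. 1183–1184)] -/
theorem natCast_mul_eq_mul_val [NeZero M] [NeZero (d * M)] (a : ℕ) :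
    ((d * a : ℕ) : ZMod (d * M)) = ((d : ℕ) : ZMod (d * M)) * (((a : ZMod M)).val : ZMod (d * M)) := by
  have h := mul_natCast_val_castHom (M := M) (d := d) ((a : ℕ) : ZMod (d * M))
  rw [map_natCast] at h
  rw [h, Nat.cast_mul]

/-- **Equal pull-backs come from equal sets**: `H_{(da′,db′,dc′)} = H_{(da,db,dc)}` modulo `dM` (`d ≥ 1`) implies `H_{(a′,b′,c′)} =
H_{(a,b,c)}` modulo `M` — every unit modulo `M` lifts to a unit modulo `dM` (`ZMod.unitsMap_surjective`) and membership pulls back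
(sibling `mem_fermatCMType_level_mul_iff`).  Converse of the sibling's `fermatCMType_level_mul_eq_of_eq`.
[cite: KoblitzRohrlich1978, §1 (pp. 1183–1184)] -/
theorem fermatCMType_eq_of_fermatCMType_level_mul_eq [NeZero M] [NeZero (d * M)] (hd : 0 < d) {a b c a' b' c' : ℕ}
    (h : fermatCMType (d * M) ((d * a' : ℕ) : ZMod (d * M)) ((d * b' : ℕ) : ZMod (d * M)) ((d * c' : ℕ) : ZMod (d * M)) =
      fermatCMType (d * M) ((d * a : ℕ) : ZMod (d * M)) ((d * b : ℕ) : ZMod (d * M)) ((d * c : ℕ) : ZMod (d * M))) :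
    fermatCMType M (a' : ZMod M) (b' : ZMod M) (c' : ZMod M) = fermatCMType M (a : ZMod M) (b : ZMod M) (c : ZMod M) := by
  have key : ∀ {a b c a' b' c' : ℕ},
      fermatCMType (d * M) ((d * a' : ℕ) : ZMod (d * M)) ((d * b' : ℕ) : ZMod (d * M)) ((d * c' : ℕ) : ZMod (d * M)) =
        fermatCMType (d * M) ((d * a : ℕ) : ZMod (d * M)) ((d * b : ℕ) : ZMod (d * M)) ((d * c : ℕ) : ZMod (d * M)) →
      ∀ z : ZMod M, z ∈ fermatCMType M (a' : ZMod M) (b' : ZMod M) (c' : ZMod M) →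
        z ∈ fermatCMType M (a : ZMod M) (b : ZMod M) (c : ZMod M) := by
    intro a b c a' b' c' h z hz
    have hzu : IsUnit z := isUnit_of_mem_fermatCMType hz
    obtain ⟨W, hW⟩ := ZMod.unitsMap_surjective (dvd_mul_left M d) hzu.unit
    have hWz : ZMod.castHom (dvd_mul_left M d) (ZMod M) (W : ZMod (d * M)) = z := by
      have h1 := congrArg (fun u : (ZMod M)ˣ => (u : ZMod M)) hW
      simp only [ZMod.unitsMap_val, IsUnit.unit_spec] at h1
      rw [ZMod.castHom_apply]
      exact h1
    have hWc : (W : ZMod (d * M)).val.Coprime (d * M) := by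
      have := (ZMod.isUnit_iff_coprime (W : ZMod (d * M)).val (d * M))
      rw [ZMod.natCast_zmod_val] at this
      exact this.1 (Units.isUnit W)
    have hmem : (W : ZMod (d * M)) ∈ fermatCMType (d * M) ((d * a' : ℕ) : ZMod (d * M)) ((d * b' : ℕ) : ZMod (d * M))
        ((d * c' : ℕ) : ZMod (d * M)) := by
      rw [mem_fermatCMType_level_mul_iff hd, hWz]
      exact ⟨hWc, hz⟩
    rw [h, mem_fermatCMType_level_mul_iff hd, hWz] at hmem
    exact hmem.2
  ext z
  exact ⟨key h z, key h.symm z⟩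

/-- **The change of level as an equivalence**: `H_{(da′,db′,dc′)} = H_{(da,db,dc)}` modulo `dM` iff `H_{(a′,b′,c′)} = H_{(a,b,c)}`
modulo `M` (`d ≥ 1`). [cite: KoblitzRohrlich1978, §1 (pp. 1183–1184)] -/
theorem fermatCMType_level_mul_eq_iff [NeZero M] [NeZero (d * M)] (hd : 0 < d) {a b c a' b' c' : ℕ} :
    fermatCMType (d * M) ((d * a' : ℕ) : ZMod (d * M)) ((d * b' : ℕ) : ZMod (d * M)) ((d * c' : ℕ) : ZMod (d * M)) =
        fermatCMType (d * M) ((d * a : ℕ) : ZMod (d * M)) ((d * b : ℕ) : ZMod (d * M)) ((d * c : ℕ) : ZMod (d * M)) ↔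
      fermatCMType M (a' : ZMod M) (b' : ZMod M) (c' : ZMod M) = fermatCMType M (a : ZMod M) (b : ZMod M) (c : ZMod M) :=
  ⟨fermatCMType_eq_of_fermatCMType_level_mul_eq hd, fun h => fermatCMType_level_mul_eq_of_eq hd h⟩

/-- The image of a triple under a map. [folklore] -/
private theorem map_triple' {α β : Type*} (F : α → β) (x y z : α) :
    (({x, y, z} : Multiset α).map F) = {F x, F y, F z} := by
  simp only [Multiset.insert_eq_cons, Multiset.map_cons, Multiset.map_singleton]

/-- **Permutations lift along the change of level**: `{a′,b′,c′} = {a,b,c}` modulo `M` implies `{da′,db′,dc′} = {da,db,dc}` modulo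
`dM` (apply the transfer map `z ↦ d·⟨z⟩`). [cite: KoblitzRohrlich1978, §1 (pp. 1183–1184)] -/
theorem multiset_level_mul_eq_of_multiset_eq [NeZero M] [NeZero (d * M)] {a b c a' b' c' : ℕ}
    (h : ({(a' : ZMod M), (b' : ZMod M), (c' : ZMod M)} : Multiset (ZMod M)) = {(a : ZMod M), (b : ZMod M), (c : ZMod M)}) :
    ({((d * a' : ℕ) : ZMod (d * M)), ((d * b' : ℕ) : ZMod (d * M)), ((d * c' : ℕ) : ZMod (d * M))} : Multiset (ZMod (d * M))) =
      {((d * a : ℕ) : ZMod (d * M)), ((d * b : ℕ) : ZMod (d * M)), ((d * c : ℕ) : ZMod (d * M))} := by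
  have hc := congrArg (Multiset.map fun z : ZMod M => ((d : ℕ) : ZMod (d * M)) * (z.val : ZMod (d * M))) h
  rw [map_triple', map_triple'] at hc
  rw [natCast_mul_eq_mul_val a', natCast_mul_eq_mul_val b', natCast_mul_eq_mul_val c', natCast_mul_eq_mul_val a,
    natCast_mul_eq_mul_val b, natCast_mul_eq_mul_val c]
  exact hc

end Level

/-! ## §2 Transport along an equality of levels `N = N′` -/

section Transport

variable {N N' : ℕ}

/-- Equality of Fermat sets is invariant under the identification `ℤ/N = ℤ/N′` for `N = N′` (Mathlib `ZMod.ringEquivCongr`; used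
with `p^(k+1) = p·pᵏ`; private plumbing). [folklore] -/
private theorem fermatCMType_ringEquivCongr_eq_iff [NeZero N] [NeZero N'] (h : N = N') (r s t r' s' t' : ZMod N) :
    fermatCMType N' (ZMod.ringEquivCongr h r') (ZMod.ringEquivCongr h s') (ZMod.ringEquivCongr h t') =
        fermatCMType N' (ZMod.ringEquivCongr h r) (ZMod.ringEquivCongr h s) (ZMod.ringEquivCongr h t) ↔
      fermatCMType N r' s' t' = fermatCMType N r s t := by
  subst h
  simp only [ZMod.ringEquivCongr_refl, RingEquiv.refl_apply]

/-- Equality of triples (as multisets) is invariant under `ℤ/N = ℤ/N′` for `N = N′` (private plumbing). [folklore] -/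
private theorem multiset_ringEquivCongr_eq_iff (h : N = N') (r s t r' s' t' : ZMod N) :
    ({ZMod.ringEquivCongr h r', ZMod.ringEquivCongr h s', ZMod.ringEquivCongr h t'} : Multiset (ZMod N')) =
        {ZMod.ringEquivCongr h r, ZMod.ringEquivCongr h s, ZMod.ringEquivCongr h t} ↔
      ({r', s', t'} : Multiset (ZMod N)) = {r, s, t} := by
  subst h
  simp only [ZMod.ringEquivCongr_refl, RingEquiv.refl_apply]

end Transport

/-! ## §3 Descent `p^(k+1) → pᵏ`: non-unit entries are `p·a₁` -/

section Descent

variable {p : ℕ} [hp : Fact p.Prime] {k : ℕ}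

/-- **A non-zero non-unit residue `a` modulo `p^(k+1)` is `p·a₁` with `a₁ = ⟨a⟩/p` non-zero modulo `pᵏ`**, and under `ℤ/p^(k+1) =
ℤ/(p·pᵏ)` it reads `p·a₁` ("`N/M = g.c.d.(N, r, s)`": dividing out the common `p`). [cite: KoblitzRohrlich1978, §1 (pp. 1183–1184)] -/
theorem exists_val_eq_mul_of_not_isUnit {a : ZMod (p ^ (k + 1))} (ha : a ≠ 0) (hau : ¬IsUnit a) :
    ∃ a₁ : ℕ, a.val = p * a₁ ∧ ((a₁ : ℕ) : ZMod (p ^ k)) ≠ 0 ∧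
      ZMod.ringEquivCongr (pow_succ' p k) a = ((p * a₁ : ℕ) : ZMod (p * p ^ k)) := by
  have hdvd : p ∣ a.val := by
    have h := (not_isUnit_iff_castHom_eq_zero (Nat.succ_ne_zero k) a).1 hau
    rw [ZMod.castHom_apply, ZMod.cast_eq_val, ZMod.natCast_eq_zero_iff] at h
    exact h
  refine ⟨a.val / p, (Nat.mul_div_cancel' hdvd).symm, ?_, ?_⟩
  · have hv0 : a.val ≠ 0 := fun h => ha ((ZMod.val_eq_zero a).1 h)
    have hlt : a.val < p * p ^ k := by rw [← pow_succ']; exact ZMod.val_lt a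
    have h1 : a.val / p < p ^ k := (Nat.div_lt_iff_lt_mul hp.out.pos).2 (by rw [mul_comm]; exact hlt)
    have h2 : 0 < a.val / p := Nat.div_pos (Nat.le_of_dvd (Nat.pos_of_ne_zero hv0) hdvd) hp.out.pos
    rw [Ne, ZMod.natCast_eq_zero_iff]
    intro h
    exact absurd (Nat.le_of_dvd h2 h) (by omega)
  · conv_lhs => rw [← ZMod.natCast_zmod_val a]
    rw [map_natCast, Nat.mul_div_cancel' hdvd]

/-- Sums descend: `r + s + t = 0` modulo `p^(k+1)` with `⟨r⟩ = p r₁`, `⟨s⟩ = p s₁`, `⟨t⟩ = p t₁` gives `r₁ + s₁ + t₁ = 0` modulo `pᵏ`.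
[cite: KoblitzRohrlich1978, §1 (pp. 1183–1184)] -/
theorem natCast_add_eq_zero_of_val_eq_mul {r s t : ZMod (p ^ (k + 1))} (hrst : r + s + t = 0) {r₁ s₁ t₁ : ℕ}
    (hr : r.val = p * r₁) (hs : s.val = p * s₁) (ht : t.val = p * t₁) :
    (r₁ : ZMod (p ^ k)) + (s₁ : ZMod (p ^ k)) + (t₁ : ZMod (p ^ k)) = 0 := by
  have h1 : ((r.val + s.val + t.val : ℕ) : ZMod (p ^ (k + 1))) = 0 := by
    rw [Nat.cast_add, Nat.cast_add, ZMod.natCast_zmod_val, ZMod.natCast_zmod_val, ZMod.natCast_zmod_val, hrst]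
  rw [ZMod.natCast_eq_zero_iff, hr, hs, ht, ← mul_add, ← mul_add, pow_succ'] at h1
  have h2 : p ^ k ∣ r₁ + s₁ + t₁ := Nat.dvd_of_mul_dvd_mul_left hp.out.pos h1
  have h3 : ((r₁ + s₁ + t₁ : ℕ) : ZMod (p ^ k)) = 0 := (ZMod.natCast_eq_zero_iff _ _).2 h2
  rw [Nat.cast_add, Nat.cast_add] at h3
  exact h3

end Descent

/-! ## §4 `N = pⁿ`, `p ≥ 5`: all coincidences are permutations — no g.c.d. hypothesis -/

section AllTriples

open CategoryTheory
open Literature.AlgebraicGeometry.Motives (AbelianVariety)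
open Literature.AlgebraicGeometry.HodgeTheory
open CyclotomicCMTypeResidueSets (unitResidues IsCMResidueSet)

variable {p : ℕ} [hp : Fact p.Prime]

/-- The induction behind `multiset_eq_of_fermatCMType_eq_primePow_all` (statement with all variables bound, for `induction n`).
[cite: KoblitzRohrlich1978, Theorem 1 (i) (p. 1185), §3 Proposition (p. 1193), §1 (pp. 1183–1184)] -/
private theorem multiset_eq_of_fermatCMType_eq_primePow_aux (hp5 : 5 ≤ p) :
    ∀ n : ℕ, n ≠ 0 → ∀ r s t r' s' t' : ZMod (p ^ n), r ≠ 0 → s ≠ 0 → t ≠ 0 → r + s + t = 0 →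
      r' ≠ 0 → s' ≠ 0 → t' ≠ 0 → r' + s' + t' = 0 → fermatCMType (p ^ n) r' s' t' = fermatCMType (p ^ n) r s t →
      ({r', s', t'} : Multiset (ZMod (p ^ n))) = {r, s, t} := by
  intro n
  induction n with
  | zero => exact fun h => (h rfl).elim
  | succ k ih =>
    intro _ r s t r' s' t' hr0 hs0 ht0 hrst hr'0 hs'0 ht'0 hrst' heq
    by_cases hunit : IsUnit r ∨ IsUnit s ∨ IsUnit t ∨ IsUnit r' ∨ IsUnit s' ∨ IsUnit t'
    · exact multiset_eq_of_fermatCMType_eq_primePow_five_le hp5 (Nat.succ_ne_zero k) hr0 hs0 ht0 hrst hr'0 hs'0 ht'0 hrst'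
        hunit heq
    · simp only [not_or] at hunit
      obtain ⟨hru, hsu, htu, hr'u, hs'u, ht'u⟩ := hunit
      have hk : k ≠ 0 := by
        have h2 := two_le_of_not_isUnit (p := p) hr0 hru
        omega
      -- all six entries are `p·a₁`
      obtain ⟨r₁, er, hr₁, Er⟩ := exists_val_eq_mul_of_not_isUnit hr0 hru
      obtain ⟨s₁, es, hs₁, Es⟩ := exists_val_eq_mul_of_not_isUnit hs0 hsu
      obtain ⟨t₁, et, ht₁, Et⟩ := exists_val_eq_mul_of_not_isUnit ht0 htu
      obtain ⟨r₁', er', hr₁', Er'⟩ := exists_val_eq_mul_of_not_isUnit hr'0 hr'u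
      obtain ⟨s₁', es', hs₁', Es'⟩ := exists_val_eq_mul_of_not_isUnit hs'0 hs'u
      obtain ⟨t₁', et', ht₁', Et'⟩ := exists_val_eq_mul_of_not_isUnit ht'0 ht'u
      have hsum := natCast_add_eq_zero_of_val_eq_mul hrst er es et
      have hsum' := natCast_add_eq_zero_of_val_eq_mul hrst' er' es' et'
      -- the coincidence at level `p·pᵏ`, then at level `pᵏ`
      have heq1 : fermatCMType (p * p ^ k) ((p * r₁' : ℕ) : ZMod (p * p ^ k)) ((p * s₁' : ℕ) : ZMod (p * p ^ k))
          ((p * t₁' : ℕ) : ZMod (p * p ^ k)) =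
          fermatCMType (p * p ^ k) ((p * r₁ : ℕ) : ZMod (p * p ^ k)) ((p * s₁ : ℕ) : ZMod (p * p ^ k))
            ((p * t₁ : ℕ) : ZMod (p * p ^ k)) := by
        rw [← Er, ← Es, ← Et, ← Er', ← Es', ← Et', fermatCMType_ringEquivCongr_eq_iff]
        exact heq
      have heqk := fermatCMType_eq_of_fermatCMType_level_mul_eq hp.out.pos heq1
      -- induction, and lift the permutation back
      have hperm := ih hk _ _ _ _ _ _ hr₁ hs₁ ht₁ hsum hr₁' hs₁' ht₁' hsum' heqk
      have hup := multiset_level_mul_eq_of_multiset_eq (d := p) (M := p ^ k) hperm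
      rw [← Er, ← Es, ← Et, ← Er', ← Es', ← Et', multiset_ringEquivCongr_eq_iff] at hup
      exact hup

/-- **KOBLITZ–ROHRLICH THEOREM 1 (i) AT `N = pⁿ`, `p ≥ 5`, FOR ALL PAIRS OF TRIPLES — NO g.c.d. HYPOTHESIS.**  For triples
`τ = (r,s,t)`, `τ′ = (r′,s′,t′)` of non-zero residues modulo `pⁿ` (`p ≥ 5` prime, `n ≥ 1`) with `r + s + t = 0 = r′ + s′ + t′`:
**if `H_{τ′} = H_τ` then `τ′` is a permutation of `τ`** (`{r′,s′,t′} = {r,s,t}`).  With a unit among the six entries this is the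
sibling's `multiset_eq_of_fermatCMType_eq_primePow_five_le` (Theorem 1 (i) + §3 Proposition); in general all six entries are
multiples of `p`, `H_τ` is the pull-back of a level-`pⁿ⁻¹` set (§1, "`N/M = g.c.d.(N, r, s)`"), the coincidence descends and the
permutation lifts — induction on `n`. [cite: KoblitzRohrlich1978, Theorem 1 (i) (p. 1185), §3 Proposition (p. 1193), §1 (pp. 1183–1184)] -/
theorem multiset_eq_of_fermatCMType_eq_primePow_all (hp5 : 5 ≤ p) {n : ℕ} (hn : n ≠ 0) {r s t r' s' t' : ZMod (p ^ n)}
    (hr0 : r ≠ 0) (hs0 : s ≠ 0) (ht0 : t ≠ 0) (hrst : r + s + t = 0)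
    (hr'0 : r' ≠ 0) (hs'0 : s' ≠ 0) (ht'0 : t' ≠ 0) (hrst' : r' + s' + t' = 0)
    (heq : fermatCMType (p ^ n) r' s' t' = fermatCMType (p ^ n) r s t) :
    ({r', s', t'} : Multiset (ZMod (p ^ n))) = {r, s, t} :=
  multiset_eq_of_fermatCMType_eq_primePow_aux hp5 n hn r s t r' s' t' hr0 hs0 ht0 hrst hr'0 hs'0 ht'0 hrst' heq

/-- **`H_{τ′} = H_τ ⟺ {τ′} = {τ}` at `N = pⁿ`, `p ≥ 5`, for all triples of non-zero residues with sums `0`.**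
[cite: KoblitzRohrlich1978, Theorem 1 (i) (p. 1185), §3 Proposition (p. 1193), §1 (pp. 1183–1184)] -/
theorem fermatCMType_eq_iff_multiset_eq_primePow_all (hp5 : 5 ≤ p) {n : ℕ} (hn : n ≠ 0) {r s t r' s' t' : ZMod (p ^ n)}
    (hr0 : r ≠ 0) (hs0 : s ≠ 0) (ht0 : t ≠ 0) (hrst : r + s + t = 0)
    (hr'0 : r' ≠ 0) (hs'0 : s' ≠ 0) (ht'0 : t' ≠ 0) (hrst' : r' + s' + t' = 0) :
    fermatCMType (p ^ n) r' s' t' = fermatCMType (p ^ n) r s t ↔ ({r', s', t'} : Multiset (ZMod (p ^ n))) = {r, s, t} :=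
  ⟨multiset_eq_of_fermatCMType_eq_primePow_all hp5 hn hr0 hs0 ht0 hrst hr'0 hs'0 ht'0 hrst', fun h => fermatCMType_eq_of_multiset_eq h⟩

/-- **The translate form, all triples**: for a unit `u`, `(∀ x, x ∈ H_{τ′} ↔ ux ∈ H_τ)` iff `{r′,s′,t′} = {ur, us, ut}` (`N = pⁿ`,
`p ≥ 5`; "`hH_{r,s} = H_{r′,s′}` for some `h`"). [cite: KoblitzRohrlich1978, Theorem 1 (p. 1185) and §1 (p. 1184)] -/
theorem forall_mem_fermatCMType_iff_iff_multiset_eq_primePow_all (hp5 : 5 ≤ p) {n : ℕ} (hn : n ≠ 0)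
    {r s t r' s' t' u : ZMod (p ^ n)} (hr0 : r ≠ 0) (hs0 : s ≠ 0) (ht0 : t ≠ 0) (hrst : r + s + t = 0)
    (hr'0 : r' ≠ 0) (hs'0 : s' ≠ 0) (ht'0 : t' ≠ 0) (hrst' : r' + s' + t' = 0) (hu : IsUnit u) :
    (∀ x, x ∈ fermatCMType (p ^ n) r' s' t' ↔ u * x ∈ fermatCMType (p ^ n) r s t) ↔
      ({r', s', t'} : Multiset (ZMod (p ^ n))) = {u * r, u * s, u * t} := by
  rw [forall_mem_iff_eq_mul hu]
  have h1 : u * r ≠ 0 := fun h => hr0 (hu.mul_right_eq_zero.mp h)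
  have h2 : u * s ≠ 0 := fun h => hs0 (hu.mul_right_eq_zero.mp h)
  have h3 : u * t ≠ 0 := fun h => ht0 (hu.mul_right_eq_zero.mp h)
  have h4 : u * r + u * s + u * t = 0 := by rw [← mul_add, ← mul_add, hrst, mul_zero]
  exact fermatCMType_eq_iff_multiset_eq_primePow_all hp5 hn h1 h2 h3 h4 hr'0 hs'0 ht'0 hrst'

variable {n : ℕ} {L : Type} [Field L] [NumberField L] [IsCyclotomicExtension {p ^ n} ℚ L]
  {A A' : AbelianVariety ℂ} {ι : 𝓞 L →+* End A} {θ : L →+* Module.End ℂ (complexBetti A.X 1)}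
  {ι' : 𝓞 L →+* End A'} {θ' : L →+* Module.End ℂ (complexBetti A'.X 1)}

/-- **THEOREM 1 (ii) ON ABELIAN VARIETIES AT `N = pⁿ`, `p ≥ 5`, FOR ALL ADMISSIBLE TRIPLES**: for any triples `(r,s,t)`, `(r′,s′,t′)`
of non-zero residues modulo `pⁿ` (`n ≥ 1`) with `r + s + t = 0 = r′ + s′ + t′`, abelian varieties `A`, `A′` of types `Φ_{H_{r,s,t}}`,
`Φ_{H_{r′,s′,t′}}` of `ℚ(ζ_{pⁿ})` are ISOGENOUS iff `{r′,s′,t′} = {ur, us, ut}` for a unit `u` ("the only isogenies … are the obvious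
equalities", for the types read at the full level `pⁿ` — no g.c.d. hypothesis).
[cite: KoblitzRohrlich1978, Theorem 1 (ii) (p. 1185) and §1 (p. 1184)] [cite: Shimura1998, §8.4 Example (1) and §6.1 Corollary] -/
theorem isIsogenous_fermatCMType_iff_exists_multiset_eq_primePow_all [IsCMField L] (hp5 : 5 ≤ p) (hn : n ≠ 0)
    {r s t r' s' t' : ZMod (p ^ n)} (hr0 : r ≠ 0) (hs0 : s ≠ 0) (ht0 : t ≠ 0) (hrst : r + s + t = 0)
    (hr'0 : r' ≠ 0) (hs'0 : s' ≠ 0) (ht'0 : t' ≠ 0) (hrst' : r' + s' + t' = 0)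
    (hS : IsCMResidueSet (p ^ n) (fermatCMType (p ^ n) r s t))
    (hS' : IsCMResidueSet (p ^ n) (fermatCMType (p ^ n) r' s' t'))
    (hA : IsCMTypeRealisation (cmTypeOfResidues (L := L) (fermatCMType (p ^ n) r s t) hS.cm) A ι θ)
    (hA' : IsCMTypeRealisation (cmTypeOfResidues (L := L) (fermatCMType (p ^ n) r' s' t') hS'.cm) A' ι' θ') :
    AbelianVariety.IsIsogenous A A' ↔
      ∃ u : ZMod (p ^ n), IsUnit u ∧ ({r', s', t'} : Multiset (ZMod (p ^ n))) = {u * r, u * s, u * t} := by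
  rw [isIsogenous_fermatCMType_iff_exists_eq_mul hS hS' hA hA']
  refine exists_congr fun u => and_congr_right fun hu => ?_
  rw [← forall_mem_iff_eq_mul hu]
  exact forall_mem_fermatCMType_iff_iff_multiset_eq_primePow_all hp5 hn hr0 hs0 ht0 hrst hr'0 hs'0 ht'0 hrst' hu

end AllTriples

/-! ## §5 `N = 3ⁿ`: THEOREM 3 VERBATIM, every `n`, for all pairs of triples, in the one type `ℤ/3ⁿ` -/

section Lift

variable {p : ℕ} [hp : Fact p.Prime] {k : ℕ}

omit hp in
/-- `p·⟨x mod pᵏ⟩ = p·x` modulo `p^(k+1)`. [cite: KoblitzRohrlich1978, §1 (pp. 1183–1184)] -/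
theorem natCast_mul_val_natCast_eq (x : ℕ) :
    ((p * ((x : ZMod (p ^ k))).val : ℕ) : ZMod (p ^ (k + 1))) = ((p * x : ℕ) : ZMod (p ^ (k + 1))) := by
  rw [ZMod.val_natCast, ZMod.natCast_eq_natCast_iff', pow_succ', Nat.mul_mod_mul_left, Nat.mul_mod_mul_left, Nat.mod_mod]

omit hp in
/-- **Permutations lift from level `pᵏ` to level `p^(k+1)`**: `{a′,b′,c′} = {a,b,c}` modulo `pᵏ` implies `{pa′,pb′,pc′} = {pa,pb,pc}`
modulo `p^(k+1)` (the transfer map `z ↦ p·⟨z⟩`). [cite: KoblitzRohrlich1978, §1 (pp. 1183–1184)] -/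
theorem multiset_mul_eq_of_multiset_eq_succ {a b c a' b' c' : ℕ}
    (h : ({(a' : ZMod (p ^ k)), (b' : ZMod (p ^ k)), (c' : ZMod (p ^ k))} : Multiset (ZMod (p ^ k))) =
      {(a : ZMod (p ^ k)), (b : ZMod (p ^ k)), (c : ZMod (p ^ k))}) :
    ({((p * a' : ℕ) : ZMod (p ^ (k + 1))), ((p * b' : ℕ) : ZMod (p ^ (k + 1))), ((p * c' : ℕ) : ZMod (p ^ (k + 1)))} :
        Multiset (ZMod (p ^ (k + 1)))) =
      {((p * a : ℕ) : ZMod (p ^ (k + 1))), ((p * b : ℕ) : ZMod (p ^ (k + 1))), ((p * c : ℕ) : ZMod (p ^ (k + 1)))} := by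
  have hc := congrArg (Multiset.map fun z : ZMod (p ^ k) => ((p * z.val : ℕ) : ZMod (p ^ (k + 1)))) h
  rw [map_triple', map_triple'] at hc
  simp only [natCast_mul_val_natCast_eq] at hc
  exact hc

/-- **Units lift from level `pᵏ` to level `p^(k+1)` compatibly with the transfer map**: for a unit `w₀` modulo `pᵏ` there is a unit `W`
modulo `p^(k+1)` with `W·(pa) = p·x` modulo `p^(k+1)` whenever `w₀·a = x` modulo `pᵏ` (`a, x` naturals) — "for some `u ∈ (ℤ/Nℤ)*`,
`uτ = (⟨ur⟩, ⟨us⟩, ⟨ut⟩)`" one level up. [cite: KoblitzRohrlich1978, §1 (pp. 1183–1184) and §4 Proposition (p. 1198)] -/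
theorem exists_unit_mul_natCast_mul_eq {w₀ : ZMod (p ^ k)} (hw₀ : IsUnit w₀) :
    ∃ W : ZMod (p ^ (k + 1)), IsUnit W ∧ ∀ a x : ℕ, w₀ * (a : ZMod (p ^ k)) = (x : ZMod (p ^ k)) →
      W * ((p * a : ℕ) : ZMod (p ^ (k + 1))) = ((p * x : ℕ) : ZMod (p ^ (k + 1))) := by
  obtain ⟨W₀, hW₀⟩ := ZMod.unitsMap_surjective (dvd_mul_left (p ^ k) p) hw₀.unit
  have hWw : ZMod.castHom (dvd_mul_left (p ^ k) p) (ZMod (p ^ k)) (W₀ : ZMod (p * p ^ k)) = w₀ := by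
    have h1 := congrArg (fun u : (ZMod (p ^ k))ˣ => (u : ZMod (p ^ k))) hW₀
    simp only [ZMod.unitsMap_val, IsUnit.unit_spec] at h1
    rw [ZMod.castHom_apply]
    exact h1
  refine ⟨(ZMod.ringEquivCongr (pow_succ' p k)).symm (W₀ : ZMod (p * p ^ k)),
    (Units.isUnit W₀).map (ZMod.ringEquivCongr (pow_succ' p k)).symm, fun a x hax => ?_⟩
  have key : (W₀ : ZMod (p * p ^ k)) * ((p * a : ℕ) : ZMod (p * p ^ k)) = ((p * x : ℕ) : ZMod (p * p ^ k)) := by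
    rw [natCast_mul_eq_mul_val a, natCast_mul_eq_mul_val x, ← hax, mul_left_comm,
      ← mul_natCast_val_castHom ((W₀ : ZMod (p * p ^ k)) * (((a : ZMod (p ^ k))).val : ZMod (p * p ^ k))), map_mul, hWw,
      map_natCast, ZMod.natCast_zmod_val]
  have h := congrArg (ZMod.ringEquivCongr (pow_succ' p k)).symm key
  rw [map_mul, map_natCast, map_natCast] at h
  exact h

/-- **A unit relation between triples lifts one level up**: if `{w₀a, w₀b, w₀c} = {x, y, z}` modulo `pᵏ` (`w₀` a unit; `a, …, z`
naturals), then for the unit `W` of the previous lemma `{W·pa, W·pb, W·pc} = {px, py, pz}` modulo `p^(k+1)`.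
[cite: KoblitzRohrlich1978, §1 (pp. 1183–1184) and §4 Proposition (p. 1198)] -/
theorem exists_unit_multiset_mul_eq_succ {w₀ : ZMod (p ^ k)} (hw₀ : IsUnit w₀) :
    ∃ W : ZMod (p ^ (k + 1)), IsUnit W ∧ ∀ a b c x y z : ℕ,
      ({w₀ * (a : ZMod (p ^ k)), w₀ * (b : ZMod (p ^ k)), w₀ * (c : ZMod (p ^ k))} : Multiset (ZMod (p ^ k))) =
          {(x : ZMod (p ^ k)), (y : ZMod (p ^ k)), (z : ZMod (p ^ k))} →
        ({W * ((p * a : ℕ) : ZMod (p ^ (k + 1))), W * ((p * b : ℕ) : ZMod (p ^ (k + 1))), W * ((p * c : ℕ) : ZMod (p ^ (k + 1)))} :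
            Multiset (ZMod (p ^ (k + 1)))) =
          {((p * x : ℕ) : ZMod (p ^ (k + 1))), ((p * y : ℕ) : ZMod (p ^ (k + 1))), ((p * z : ℕ) : ZMod (p ^ (k + 1)))} := by
  obtain ⟨W, hW, hmul⟩ := exists_unit_mul_natCast_mul_eq hw₀
  refine ⟨W, hW, fun a b c x y z h => ?_⟩
  have hG : ∀ a : ℕ, ((p * (w₀ * (a : ZMod (p ^ k))).val : ℕ) : ZMod (p ^ (k + 1))) = W * ((p * a : ℕ) : ZMod (p ^ (k + 1))) :=
    fun a => (hmul a _ (ZMod.natCast_zmod_val _).symm).symm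
  have hc := congrArg (Multiset.map fun z : ZMod (p ^ k) => ((p * z.val : ℕ) : ZMod (p ^ (k + 1)))) h
  rw [map_triple', map_triple'] at hc
  simp only [natCast_mul_val_natCast_eq, hG] at hc
  exact hc

end Lift

section ThreeAll

/-- The arithmetic of the lift `m ↦ m + 1` of Theorem 3's triples (`k ≥ 1`): `3·3ᵐ = 3ᵐ⁺¹`, `3(3ᵏ⁻¹ − 2·3ᵐ) = 3ᵏ − 2·3ᵐ⁺¹`,
`3(2·3ᵏ⁻¹ + 3ᵐ) = 2·3ᵏ + 3ᵐ⁺¹`, `3·3ᵐ⁺¹ = 3ᵐ⁺²`, `3(2·3ᵏ⁻¹ − 3ᵐ) = 2·3ᵏ − 3ᵐ⁺¹`. [cite: KoblitzRohrlich1978, Theorem 3 (p. 1186)] -/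
theorem threePow_lift_arith {k : ℕ} (hk : 1 ≤ k) (m : ℕ) :
    3 * 3 ^ m = 3 ^ (m + 1) ∧ 3 * (3 ^ (k - 1) - 2 * 3 ^ m) = 3 ^ (k + 1 - 1) - 2 * 3 ^ (m + 1) ∧
      3 * (2 * 3 ^ (k - 1) + 3 ^ m) = 2 * 3 ^ (k + 1 - 1) + 3 ^ (m + 1) ∧ 3 * 3 ^ (m + 1) = 3 ^ (m + 1 + 1) ∧
      3 * (2 * 3 ^ (k - 1) - 3 ^ m) = 2 * 3 ^ (k + 1 - 1) - 3 ^ (m + 1) := by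
  have h1 : 3 ^ (k + 1 - 1) = 3 * 3 ^ (k - 1) := by
    rw [← pow_succ']
    congr 1
    omega
  refine ⟨(pow_succ' 3 m).symm, ?_, ?_, (pow_succ' 3 (m + 1)).symm, ?_⟩
  · rw [h1, Nat.mul_sub, pow_succ' 3 m]; ring_nf
  · rw [h1, pow_succ' 3 m]; ring
  · rw [h1, Nat.mul_sub, pow_succ' 3 m]; ring_nf

/-- Theorem 3's pair at `m = 0` in the forms of the two siblings: `(3⁰, 3ⁿ⁻¹ − 2·3⁰, 2·3ⁿ⁻¹ + 3⁰) = (1, N₁ − 2, 2N₁ + 1)` and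
`(3¹, 3ⁿ⁻¹ − 2·3⁰, 2·3ⁿ⁻¹ − 3⁰) = (3, N₁ − 2, 2N₁ − 1)` as residues modulo `3ⁿ` (`n ≥ 2`). [cite: KoblitzRohrlich1978, Theorem 3 (p. 1186) and §4 Proposition (p. 1198)] -/
theorem threePow_pair_zero_eq {n : ℕ} (hn : 2 ≤ n) :
    (({((3 ^ 0 : ℕ) : ZMod (3 ^ n)), ((3 ^ (n - 1) - 2 * 3 ^ 0 : ℕ) : ZMod (3 ^ n)), ((2 * 3 ^ (n - 1) + 3 ^ 0 : ℕ) : ZMod (3 ^ n))} :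
        Multiset (ZMod (3 ^ n))) = {1, (3 : ZMod (3 ^ n)) ^ (n - 1) - 2, 2 * (3 : ZMod (3 ^ n)) ^ (n - 1) + 1}) ∧
    (({((3 ^ (0 + 1) : ℕ) : ZMod (3 ^ n)), ((3 ^ (n - 1) - 2 * 3 ^ 0 : ℕ) : ZMod (3 ^ n)), ((2 * 3 ^ (n - 1) - 3 ^ 0 : ℕ) : ZMod (3 ^ n))} :
        Multiset (ZMod (3 ^ n))) = {3, 2 * (3 : ZMod (3 ^ n)) ^ (n - 1) - 1, (3 : ZMod (3 ^ n)) ^ (n - 1) - 2}) := by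
  obtain ⟨e1, e2, e3⟩ := natCast_exceptional_entries hn
  constructor
  · rw [pow_zero, mul_one, Nat.cast_one, e1, e3]
  · rw [pow_zero, mul_one, zero_add, pow_one, e1, e2, Multiset.pair_comm, Nat.cast_ofNat]

/-- The induction behind `perm_or_exceptional_of_fermatCMType_eq_threePow_all`. [cite: KoblitzRohrlich1978, Theorem 3 (p. 1186), §4 Proposition (p. 1198), §1 (pp. 1183–1184)] -/
private theorem threePow_all_aux :
    ∀ n : ℕ, n ≠ 0 → ∀ r s t r' s' t' : ZMod (3 ^ n), r ≠ 0 → s ≠ 0 → t ≠ 0 → r + s + t = 0 →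
      r' ≠ 0 → s' ≠ 0 → t' ≠ 0 → r' + s' + t' = 0 → fermatCMType (3 ^ n) r' s' t' = fermatCMType (3 ^ n) r s t →
      ({r', s', t'} : Multiset (ZMod (3 ^ n))) = {r, s, t} ∨
        ∃ m : ℕ, m + 2 ≤ n ∧ ∃ w : ZMod (3 ^ n), IsUnit w ∧
          ((({w * r, w * s, w * t} : Multiset (ZMod (3 ^ n))) =
                {((3 ^ m : ℕ) : ZMod (3 ^ n)), ((3 ^ (n - 1) - 2 * 3 ^ m : ℕ) : ZMod (3 ^ n)),
                  ((2 * 3 ^ (n - 1) + 3 ^ m : ℕ) : ZMod (3 ^ n))} ∧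
              ({w * r', w * s', w * t'} : Multiset (ZMod (3 ^ n))) =
                {((3 ^ (m + 1) : ℕ) : ZMod (3 ^ n)), ((3 ^ (n - 1) - 2 * 3 ^ m : ℕ) : ZMod (3 ^ n)),
                  ((2 * 3 ^ (n - 1) - 3 ^ m : ℕ) : ZMod (3 ^ n))}) ∨
            (({w * r, w * s, w * t} : Multiset (ZMod (3 ^ n))) =
                {((3 ^ (m + 1) : ℕ) : ZMod (3 ^ n)), ((3 ^ (n - 1) - 2 * 3 ^ m : ℕ) : ZMod (3 ^ n)),
                  ((2 * 3 ^ (n - 1) - 3 ^ m : ℕ) : ZMod (3 ^ n))} ∧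
              ({w * r', w * s', w * t'} : Multiset (ZMod (3 ^ n))) =
                {((3 ^ m : ℕ) : ZMod (3 ^ n)), ((3 ^ (n - 1) - 2 * 3 ^ m : ℕ) : ZMod (3 ^ n)),
                  ((2 * 3 ^ (n - 1) + 3 ^ m : ℕ) : ZMod (3 ^ n))})) := by
  haveI h3 : Fact (Nat.Prime 3) := ⟨Nat.prime_three⟩
  intro n
  induction n with
  | zero => exact fun h => (h rfl).elim
  | succ k ih =>
    intro _ r s t r' s' t' hr0 hs0 ht0 hrst hr'0 hs'0 ht'0 hrst' heq
    by_cases hunit : IsUnit r ∨ IsUnit s ∨ IsUnit t ∨ IsUnit r' ∨ IsUnit s' ∨ IsUnit t'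
    · -- a unit among the six: the sibling's §4 Proposition (m = 0)
      by_cases hk : k = 0
      · subst hk
        have hu : ∀ {z : ZMod (3 ^ (0 + 1))}, z ≠ 0 → IsUnit z := by
          intro z hz
          by_contra hzu
          have := two_le_of_not_isUnit (p := 3) hz hzu
          omega
        exact Or.inl ((fermatCMType_eq_iff_multiset_eq_primePow (p := 3) (by norm_num) (Nat.succ_ne_zero 0) (hu hr0) (hu hs0)
          (hu ht0) hrst (hu hr'0) (hu hs'0) (hu ht'0) hrst').1 heq)
      · have hk2 : 2 ≤ k + 1 := by omega
        obtain ⟨eA, eB⟩ := threePow_pair_zero_eq hk2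
        rcases perm_or_exceptional_of_fermatCMType_eq_threePow (Nat.succ_ne_zero k) hr0 hs0 ht0 hrst hr'0 hs'0 ht'0 hrst' hunit heq
          with hperm | ⟨w, hw, hAB⟩
        · exact Or.inl hperm
        · refine Or.inr ⟨0, hk2, w, hw, ?_⟩
          rw [eA, eB]
          exact hAB
    · -- all six entries are multiples of `3`: descend to level `3ᵏ`
      simp only [not_or] at hunit
      obtain ⟨hru, hsu, htu, hr'u, hs'u, ht'u⟩ := hunit
      have hk : k ≠ 0 := by
        have h2 := two_le_of_not_isUnit (p := 3) hr0 hru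
        omega
      obtain ⟨r₁, er, hr₁, Er⟩ := exists_val_eq_mul_of_not_isUnit hr0 hru
      obtain ⟨s₁, es, hs₁, Es⟩ := exists_val_eq_mul_of_not_isUnit hs0 hsu
      obtain ⟨t₁, et, ht₁, Et⟩ := exists_val_eq_mul_of_not_isUnit ht0 htu
      obtain ⟨r₁', er', hr₁', Er'⟩ := exists_val_eq_mul_of_not_isUnit hr'0 hr'u
      obtain ⟨s₁', es', hs₁', Es'⟩ := exists_val_eq_mul_of_not_isUnit hs'0 hs'u
      obtain ⟨t₁', et', ht₁', Et'⟩ := exists_val_eq_mul_of_not_isUnit ht'0 ht'u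
      have hsum := natCast_add_eq_zero_of_val_eq_mul hrst er es et
      have hsum' := natCast_add_eq_zero_of_val_eq_mul hrst' er' es' et'
      have heq1 : fermatCMType (3 * 3 ^ k) ((3 * r₁' : ℕ) : ZMod (3 * 3 ^ k)) ((3 * s₁' : ℕ) : ZMod (3 * 3 ^ k))
          ((3 * t₁' : ℕ) : ZMod (3 * 3 ^ k)) =
          fermatCMType (3 * 3 ^ k) ((3 * r₁ : ℕ) : ZMod (3 * 3 ^ k)) ((3 * s₁ : ℕ) : ZMod (3 * 3 ^ k))
            ((3 * t₁ : ℕ) : ZMod (3 * 3 ^ k)) := by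
        rw [← Er, ← Es, ← Et, ← Er', ← Es', ← Et', fermatCMType_ringEquivCongr_eq_iff]
        exact heq
      have heqk := fermatCMType_eq_of_fermatCMType_level_mul_eq (by norm_num : 0 < 3) heq1
      -- the residues as `3·a₁` in `ℤ/3^(k+1)` itself
      have R : ∀ {a : ZMod (3 ^ (k + 1))} {a₁ : ℕ}, a.val = 3 * a₁ → ((3 * a₁ : ℕ) : ZMod (3 ^ (k + 1))) = a := by
        intro a a₁ h
        rw [← h, ZMod.natCast_zmod_val]
      rcases ih hk _ _ _ _ _ _ hr₁ hs₁ ht₁ hsum hr₁' hs₁' ht₁' hsum' heqk with hperm | ⟨m₀, hm₀, w₀, hw₀, hAB⟩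
      · left
        have hup := multiset_mul_eq_of_multiset_eq_succ (p := 3) hperm
        rw [R er, R es, R et, R er', R es', R et'] at hup
        exact hup
      · right
        obtain ⟨W, hW, hlift⟩ := exists_unit_multiset_mul_eq_succ (p := 3) hw₀
        obtain ⟨a1, a2, a3, a4, a5⟩ := threePow_lift_arith (Nat.one_le_iff_ne_zero.2 hk) m₀
        refine ⟨m₀ + 1, by omega, W, hW, ?_⟩
        rcases hAB with ⟨hA, hB⟩ | ⟨hB, hA⟩
        · left
          have h1 := hlift _ _ _ _ _ _ hA
          have h2 := hlift _ _ _ _ _ _ hB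
          rw [R er, R es, R et, a1, a2, a3] at h1
          rw [R er', R es', R et', a4, a2, a5] at h2
          exact ⟨h1, h2⟩
        · right
          have h1 := hlift _ _ _ _ _ _ hB
          have h2 := hlift _ _ _ _ _ _ hA
          rw [R er, R es, R et, a4, a2, a5] at h1
          rw [R er', R es', R et', a1, a2, a3] at h2
          exact ⟨h1, h2⟩

/-- **KOBLITZ–ROHRLICH THEOREM 3 VERBATIM — every `n`, all pairs of triples, in the one type `ℤ/3ⁿ`.**  "THEOREM 3. Suppose `N = 3ⁿ`.
Then the only isogenies apart from the obvious ones are between pairs of lattices corresponding to the triples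
`(3ᵐ, 3ⁿ⁻¹ − 2(3ᵐ), 2(3ⁿ⁻¹) + 3ᵐ)` and `(3ᵐ⁺¹, 3ⁿ⁻¹ − 2(3ᵐ), 2(3ⁿ⁻¹) − 3ᵐ)` for `0 ≤ m ≤ n − 2`."  Tree form: for ANY triples
`τ = (r,s,t)`, `τ′ = (r′,s′,t′)` of non-zero residues modulo `3ⁿ` (`n ≥ 1`) with `r + s + t = 0 = r′ + s′ + t′`, if `H_{τ′} = H_τ` then
EITHER `{τ′} = {τ}` OR there are `m` with `m + 2 ≤ n` and a unit `w` such that `(wτ, wτ′)` is, up to order inside each triple,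
`((3ᵐ, 3ⁿ⁻¹ − 2·3ᵐ, 2·3ⁿ⁻¹ + 3ᵐ), (3ᵐ⁺¹, 3ⁿ⁻¹ − 2·3ᵐ, 2·3ⁿ⁻¹ − 3ᵐ))` or the same with `τ, τ′` exchanged (induction on `n`: a unit
among the six ⟹ the sibling's §4 Proposition, `m = 0`; otherwise all six are multiples of `3`, the coincidence descends to level
`3ⁿ⁻¹` and the answer lifts with `m ↦ m + 1` — "`N/M = g.c.d.(N, r, s)`").  The sibling `…ThreePowerLevelComplete` has the same
list at the product level `3ᵐ·3ᵏ` for entries given as `3ᵐ`-multiples of naturals; here no g.c.d. is prescribed.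
[cite: KoblitzRohrlich1978, Theorem 3 (p. 1186), §4 Proposition (p. 1198), §1 (pp. 1183–1184)] -/
theorem perm_or_exceptional_of_fermatCMType_eq_threePow_all {n : ℕ} (hn : n ≠ 0) {r s t r' s' t' : ZMod (3 ^ n)}
    (hr0 : r ≠ 0) (hs0 : s ≠ 0) (ht0 : t ≠ 0) (hrst : r + s + t = 0)
    (hr'0 : r' ≠ 0) (hs'0 : s' ≠ 0) (ht'0 : t' ≠ 0) (hrst' : r' + s' + t' = 0)
    (heq : fermatCMType (3 ^ n) r' s' t' = fermatCMType (3 ^ n) r s t) :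
    ({r', s', t'} : Multiset (ZMod (3 ^ n))) = {r, s, t} ∨
      ∃ m : ℕ, m + 2 ≤ n ∧ ∃ w : ZMod (3 ^ n), IsUnit w ∧
        ((({w * r, w * s, w * t} : Multiset (ZMod (3 ^ n))) =
              {((3 ^ m : ℕ) : ZMod (3 ^ n)), ((3 ^ (n - 1) - 2 * 3 ^ m : ℕ) : ZMod (3 ^ n)),
                ((2 * 3 ^ (n - 1) + 3 ^ m : ℕ) : ZMod (3 ^ n))} ∧
            ({w * r', w * s', w * t'} : Multiset (ZMod (3 ^ n))) =
              {((3 ^ (m + 1) : ℕ) : ZMod (3 ^ n)), ((3 ^ (n - 1) - 2 * 3 ^ m : ℕ) : ZMod (3 ^ n)),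
                ((2 * 3 ^ (n - 1) - 3 ^ m : ℕ) : ZMod (3 ^ n))}) ∨
          (({w * r, w * s, w * t} : Multiset (ZMod (3 ^ n))) =
              {((3 ^ (m + 1) : ℕ) : ZMod (3 ^ n)), ((3 ^ (n - 1) - 2 * 3 ^ m : ℕ) : ZMod (3 ^ n)),
                ((2 * 3 ^ (n - 1) - 3 ^ m : ℕ) : ZMod (3 ^ n))} ∧
            ({w * r', w * s', w * t'} : Multiset (ZMod (3 ^ n))) =
              {((3 ^ m : ℕ) : ZMod (3 ^ n)), ((3 ^ (n - 1) - 2 * 3 ^ m : ℕ) : ZMod (3 ^ n)),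
                ((2 * 3 ^ (n - 1) + 3 ^ m : ℕ) : ZMod (3 ^ n))})) :=
  threePow_all_aux n hn r s t r' s' t' hr0 hs0 ht0 hrst hr'0 hs'0 ht'0 hrst' heq

/-- **THEOREM 3 AS AN EQUIVALENCE, all pairs of triples modulo `3ⁿ`**: `H_{τ′} = H_τ` iff `{τ′} = {τ}` or `(wτ, wτ′)` is one of
Theorem 3's pairs (`0 ≤ m ≤ n − 2`, up to order, or exchanged) for a unit `w` — "⟸" by the sibling's `fermatCMType_threePow_eq`
(`H_{(3ᵐ⁺¹, …)} = H_{(3ᵐ, …)}`). [cite: KoblitzRohrlich1978, Theorem 3 (p. 1186), §4 Proposition (p. 1198), §1 (pp. 1183–1184)] -/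
theorem fermatCMType_eq_iff_perm_or_exceptional_threePow_all {n : ℕ} (hn : n ≠ 0) {r s t r' s' t' : ZMod (3 ^ n)}
    (hr0 : r ≠ 0) (hs0 : s ≠ 0) (ht0 : t ≠ 0) (hrst : r + s + t = 0)
    (hr'0 : r' ≠ 0) (hs'0 : s' ≠ 0) (ht'0 : t' ≠ 0) (hrst' : r' + s' + t' = 0) :
    fermatCMType (3 ^ n) r' s' t' = fermatCMType (3 ^ n) r s t ↔
      (({r', s', t'} : Multiset (ZMod (3 ^ n))) = {r, s, t} ∨
        ∃ m : ℕ, m + 2 ≤ n ∧ ∃ w : ZMod (3 ^ n), IsUnit w ∧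
          ((({w * r, w * s, w * t} : Multiset (ZMod (3 ^ n))) =
                {((3 ^ m : ℕ) : ZMod (3 ^ n)), ((3 ^ (n - 1) - 2 * 3 ^ m : ℕ) : ZMod (3 ^ n)),
                  ((2 * 3 ^ (n - 1) + 3 ^ m : ℕ) : ZMod (3 ^ n))} ∧
              ({w * r', w * s', w * t'} : Multiset (ZMod (3 ^ n))) =
                {((3 ^ (m + 1) : ℕ) : ZMod (3 ^ n)), ((3 ^ (n - 1) - 2 * 3 ^ m : ℕ) : ZMod (3 ^ n)),
                  ((2 * 3 ^ (n - 1) - 3 ^ m : ℕ) : ZMod (3 ^ n))}) ∨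
            (({w * r, w * s, w * t} : Multiset (ZMod (3 ^ n))) =
                {((3 ^ (m + 1) : ℕ) : ZMod (3 ^ n)), ((3 ^ (n - 1) - 2 * 3 ^ m : ℕ) : ZMod (3 ^ n)),
                  ((2 * 3 ^ (n - 1) - 3 ^ m : ℕ) : ZMod (3 ^ n))} ∧
              ({w * r', w * s', w * t'} : Multiset (ZMod (3 ^ n))) =
                {((3 ^ m : ℕ) : ZMod (3 ^ n)), ((3 ^ (n - 1) - 2 * 3 ^ m : ℕ) : ZMod (3 ^ n)),
                  ((2 * 3 ^ (n - 1) + 3 ^ m : ℕ) : ZMod (3 ^ n))}))) := by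
  refine ⟨perm_or_exceptional_of_fermatCMType_eq_threePow_all hn hr0 hs0 ht0 hrst hr'0 hs'0 ht'0 hrst', ?_⟩
  rintro (hperm | ⟨m, hm, w, hw, ⟨hτ, hτ'⟩ | ⟨hτ, hτ'⟩⟩)
  · exact fermatCMType_eq_of_multiset_eq hperm
  · exact (fermatCMType_mul_eq_mul_iff hw).1 ((fermatCMType_eq_of_multiset_eq hτ').trans
      ((fermatCMType_threePow_eq hm).trans (fermatCMType_eq_of_multiset_eq hτ).symm))
  · exact (fermatCMType_mul_eq_mul_iff hw).1 ((fermatCMType_eq_of_multiset_eq hτ').trans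
      ((fermatCMType_threePow_eq hm).symm.trans (fermatCMType_eq_of_multiset_eq hτ).symm))

end ThreeAll

section ThreeAllVarieties

open CategoryTheory
open Literature.AlgebraicGeometry.Motives (AbelianVariety)
open Literature.AlgebraicGeometry.HodgeTheory
open CyclotomicCMTypeResidueSets (unitResidues IsCMResidueSet)

variable {n : ℕ} {L : Type} [Field L] [NumberField L] [IsCyclotomicExtension {3 ^ n} ℚ L]
  {A A' : AbelianVariety ℂ} {ι : 𝓞 L →+* End A} {θ : L →+* Module.End ℂ (complexBetti A.X 1)}
  {ι' : 𝓞 L →+* End A'} {θ' : L →+* Module.End ℂ (complexBetti A'.X 1)}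

/-- **KOBLITZ–ROHRLICH THEOREM 3 ON ABELIAN VARIETIES, every `n`, ALL PAIRS OF ADMISSIBLE TRIPLES** (`N = 3ⁿ`, `n ≥ 1`): for ANY
triples `τ = (r,s,t)`, `τ′ = (r′,s′,t′)` of non-zero residues modulo `3ⁿ` with `r + s + t = 0 = r′ + s′ + t′`, abelian varieties `A`,
`A′` of types `Φ_{H_τ}`, `Φ_{H_{τ′}}` of `ℚ(ζ_{3ⁿ})` are ISOGENOUS iff EITHER `{r′,s′,t′} = {ur, us, ut}` for a unit `u` ("the obvious
ones") OR for some `m` with `m + 2 ≤ n` and units `w, w′` the pair `(wτ, w′τ′)` is `((3ᵐ, 3ⁿ⁻¹ − 2·3ᵐ, 2·3ⁿ⁻¹ + 3ᵐ),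
(3ᵐ⁺¹, 3ⁿ⁻¹ − 2·3ᵐ, 2·3ⁿ⁻¹ − 3ᵐ))` up to order inside each triple, or the same with the two triples exchanged — "the only isogenies
apart from the obvious ones are between pairs of lattices corresponding to the triples … for `0 ≤ m ≤ n − 2`" (Shimura–Taniyama
`A_τ ∼ A_{τ′} ⟺ H_{τ′} = H_{uτ}`, sibling `isIsogenous_fermatCMType_iff_exists_eq_mul`, composed with §5).
[cite: KoblitzRohrlich1978, Theorem 3 (p. 1186), §4 Proposition (p. 1198), §1 (p. 1184)] [cite: Shimura1998, §8.4 Example (1) and §6.1 Corollary] -/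
theorem isIsogenous_iff_obvious_or_exceptional_threePow_all [IsCMField L] (hn : n ≠ 0) {r s t r' s' t' : ZMod (3 ^ n)}
    (hr0 : r ≠ 0) (hs0 : s ≠ 0) (ht0 : t ≠ 0) (hrst : r + s + t = 0)
    (hr'0 : r' ≠ 0) (hs'0 : s' ≠ 0) (ht'0 : t' ≠ 0) (hrst' : r' + s' + t' = 0)
    (hS : IsCMResidueSet (3 ^ n) (fermatCMType (3 ^ n) r s t))
    (hS' : IsCMResidueSet (3 ^ n) (fermatCMType (3 ^ n) r' s' t'))
    (hA : IsCMTypeRealisation (cmTypeOfResidues (L := L) (fermatCMType (3 ^ n) r s t) hS.cm) A ι θ)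
    (hA' : IsCMTypeRealisation (cmTypeOfResidues (L := L) (fermatCMType (3 ^ n) r' s' t') hS'.cm) A' ι' θ') :
    AbelianVariety.IsIsogenous A A' ↔
      (∃ u : ZMod (3 ^ n), IsUnit u ∧ ({r', s', t'} : Multiset (ZMod (3 ^ n))) = {u * r, u * s, u * t}) ∨
        ∃ m : ℕ, m + 2 ≤ n ∧ ∃ w w' : ZMod (3 ^ n), IsUnit w ∧ IsUnit w' ∧
          ((({w * r, w * s, w * t} : Multiset (ZMod (3 ^ n))) =
                {((3 ^ m : ℕ) : ZMod (3 ^ n)), ((3 ^ (n - 1) - 2 * 3 ^ m : ℕ) : ZMod (3 ^ n)),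
                  ((2 * 3 ^ (n - 1) + 3 ^ m : ℕ) : ZMod (3 ^ n))} ∧
              ({w' * r', w' * s', w' * t'} : Multiset (ZMod (3 ^ n))) =
                {((3 ^ (m + 1) : ℕ) : ZMod (3 ^ n)), ((3 ^ (n - 1) - 2 * 3 ^ m : ℕ) : ZMod (3 ^ n)),
                  ((2 * 3 ^ (n - 1) - 3 ^ m : ℕ) : ZMod (3 ^ n))}) ∨
            (({w * r, w * s, w * t} : Multiset (ZMod (3 ^ n))) =
                {((3 ^ (m + 1) : ℕ) : ZMod (3 ^ n)), ((3 ^ (n - 1) - 2 * 3 ^ m : ℕ) : ZMod (3 ^ n)),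
                  ((2 * 3 ^ (n - 1) - 3 ^ m : ℕ) : ZMod (3 ^ n))} ∧
              ({w' * r', w' * s', w' * t'} : Multiset (ZMod (3 ^ n))) =
                {((3 ^ m : ℕ) : ZMod (3 ^ n)), ((3 ^ (n - 1) - 2 * 3 ^ m : ℕ) : ZMod (3 ^ n)),
                  ((2 * 3 ^ (n - 1) + 3 ^ m : ℕ) : ZMod (3 ^ n))})) := by
  rw [isIsogenous_fermatCMType_iff_exists_eq_mul hS hS' hA hA']
  constructor
  · rintro ⟨u, hu, heq⟩
    have h1 : u * r ≠ 0 := fun h => hr0 (hu.mul_right_eq_zero.mp h)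
    have h2 : u * s ≠ 0 := fun h => hs0 (hu.mul_right_eq_zero.mp h)
    have h3 : u * t ≠ 0 := fun h => ht0 (hu.mul_right_eq_zero.mp h)
    have h4 : u * r + u * s + u * t = 0 := by rw [← mul_add, ← mul_add, hrst, mul_zero]
    rcases perm_or_exceptional_of_fermatCMType_eq_threePow_all hn h1 h2 h3 h4 hr'0 hs'0 ht'0 hrst' heq with
      hperm | ⟨m, hm, w, hw, h⟩
    · exact Or.inl ⟨u, hu, hperm⟩
    · refine Or.inr ⟨m, hm, w * u, w, hw.mul hu, hw, ?_⟩
      simpa only [mul_assoc] using h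
  · rintro (⟨u, hu, hperm⟩ | ⟨m, hm, w, w', hw, hw', h⟩)
    · exact ⟨u, hu, fermatCMType_eq_of_multiset_eq hperm⟩
    · -- `H_{w′τ′} = H_{B} = H_{A} = H_{wτ}` (or with `A, B` exchanged), so `H_{τ′} = H_{w′⁻¹wτ}`
      obtain ⟨wi, hwi⟩ := hw'.exists_right_inv
      have hwi' : IsUnit wi := IsUnit.of_mul_eq_one_right w' hwi
      refine ⟨wi * w, hwi'.mul hw, ?_⟩
      have e : ∀ z : ZMod (3 ^ n), w' * (wi * w * z) = w * z := fun z => by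
        rw [← mul_assoc, ← mul_assoc, hwi, one_mul]
      apply (fermatCMType_mul_eq_mul_iff hw').1
      rw [e, e, e]
      rcases h with ⟨hτ, hτ'⟩ | ⟨hτ, hτ'⟩
      · exact (fermatCMType_eq_of_multiset_eq hτ').trans ((fermatCMType_threePow_eq hm).trans
          (fermatCMType_eq_of_multiset_eq hτ).symm)
      · exact (fermatCMType_eq_of_multiset_eq hτ').trans ((fermatCMType_threePow_eq hm).symm.trans
          (fermatCMType_eq_of_multiset_eq hτ).symm)

end ThreeAllVarieties

end CyclotomicFermatCMType

end Literature.AlgebraicGeometry.ComplexMultiplication
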